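/-
Copyright (c) 2026 the pub-hodgecm-mathlib formalisation cell (harness21).  Prover seat hodgecm-mathlib-LH5-p03 (g2): «SHALIKA-UNR ★» (LH4-plan (g3) DEALER WORD #20) —
the Shalika germ expansion for `U(Φ₃)(L⁺_v)` at every UNRAMIFIED non-split place, in-house, by bare names; 2026-09-02.
-/
import Literature.NumberTheory.Rogawski1990.ShalikaGermExpansionHoweReduction               -- ★ p848172 SH-3: THE PLUG `UnitaryGroup.shalikaGermExpansionNonsplit_of_howePackage` (brings SH-1∕SH-2, the local currency)
import Literature.NumberTheory.Rogawski1990.UnitaryThreeUnipotentClassesFiniteUnramifiedCM       -- ★ p850143 ‹U-FIN-unr› `unitaryThree_unipotent_conjClasses_finite_unramified` (LH5-p03 (g2))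
import Literature.NumberTheory.Rogawski1990.UnipotentOrbitalMeasuresExistUncondCM             -- ★ p849258 ‹RAO-EX› `…exists_orbitalMeasureFamily_isAdmissibleOn_unipotent_antidiagOne_three_nonsplit` (no parity ∕ ramification hypothesis)
import Literature.NumberTheory.Rogawski1990.UnipotentOrbitalIntegralConvergenceRegularAllCM   -- ★ p850112 ‹HCONV› `UnitaryGroup.integrable_descConj_of_isLocSmooth_of_unipotent'` (Ranga-Rao's clause, every non-split place)
import Literature.NumberTheory.Rogawski1990.UnipotentOrbitalIntegralDualPiecesUnramifiedAllCM  -- ★ p850106 ‹DUAL-unr› `UnitaryGroup.exists_unipotentDualPieces_antidiagOne_unramified` (F0P3a-p04 (g22))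
import Literature.NumberTheory.Rogawski1990.UnitaryThreeUnipotentStrataUnramifiedCM         -- ★ p850186 ‹ENUM-unr› `exists_enum_unipotent_isClosed_iUnion_lt_antidiagOne_unramified` (A-p12 (g26)); brings ★ p849265 `npow_conj_sub_one_eq_zero_iff`
import Literature.MeasureTheory.Group.OrbitalIntegralKernelDecomposition                       -- ★ p849233 ‹SPAN-e› `exists_add_mem_span_conj_sub_of_classOrbitalIntegral_eq_zero` (Howe's span property, generic; LH7-p01 (g2))
import Literature.NumberTheory.Rogawski1990.LocalTransferGlueCM                             -- ★ `totallyDisconnectedSpace_cmDatum_local` (the one instance ‹SPAN-e› wants by hand)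
import Literature.NumberTheory.Automorphic.LocalUnitaryGroupCongr                            -- ★ `antidiagOne_isHermitian`, `isUnit_antidiagOne_det` (`Φ₃` hermitian, `det Φ₃ ≠ 0`)
import HarnessLib

/-!
# The Shalika germ expansion for `U(Φ₃)(L⁺_v)` at every UNRAMIFIED non-split place — odd or dyadic — IN-HOUSE (Rogawski 1990, §8.1 Prop. 8.1.1)

Topic `NumberTheory/Rogawski1990`; namespace `Literature.NumberTheory.Rogawski1990`.  THEOREMS ONLY (no definition, no instance, no notation, no named fact, no `sorry`);
kernel lane `--supports stmt-HodgeConjecture-24833`.  Cell `pub/hodgecm-mathlib` (D-0151), crux H413 = `stmt-HodgeConjecture-24833`; half A line LH4 (closer stub `stub_N6ns`),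
DYADIC pay-down leaf `Cruxes/H413/Lines/F0_P3c_DyadicPaydown.lean` ED. 1 (a78d34cdd4c5), organ (D-SH) `stub_DyShalika` «Shalika at `Φ₃`, dyadic non-split»: this file is the ★ the
dealer's LEAF ED. 2 consumes to re-cut (D-SH) down to the WILD dyadic places (`by_cases hv : Algebra.IsUnramifiedIn (𝓞 L) v.asIdeal`).  HONEST LABEL: HC_CM is proved only modulo
the 7 printed citations (2 remaining named inputs: hLiu418 = stmt-HodgeConjecture-24832, h413 = stmt-HodgeConjecture-24833) until rung 0 closes; count-neutral until a desk edition
consumes it.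

WHAT.  ★ `ShalikaGermExpansionNonsplit L Φ₃ v` — the Shalika germ expansion of the regular-semisimple orbital integrals of `G = U(Φ₃)(L⁺_v)` near the identity in terms of
the unipotent orbital integrals [Rogawski1990 §8.1 Prop. 8.1.1; Harish-Chandra 1999 Thm. 8.1; Howe 1974 Prop. 2; Rao 1972] — at every finite place `v` of `L⁺` that is
NON-SPLIT (`Subsingleton (PlacesOver L v)`) and UNRAMIFIED in the CM field `L`, with NO hypothesis on the residue characteristic.  It is the ★ SH-3 plug
`UnitaryGroup.shalikaGermExpansionNonsplit_of_howePackage` («Prop. 8.1.1 ⟸ HOWE PACKAGE») fed with the Howe package assembled from FOUR ★ bricks by bare name: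
‹U-FIN-unr› (★ p850143: finitely many unipotent classes), ‹RAO› (★ p849258 existence of admissible orbital measures at the unipotent classes, every non-split place, +
★ p850112 Ranga-Rao's convergence clause, every non-split place), ‹DUAL-unr› (★ p850106: dual pieces `Φ_{m_U}(u, fd u′) = δ_{u u′}`), ‹SPAN› (★ p849233 Howe's span property for a
finite closed-filtered orbit stratification, generic, + ★ p850186 the closed enumeration of the unipotent classes at an unramified place).  The assembly is the glue of the ODD
leaf `Cruxes/H413/Lines/F0_P3c_ShalikaPaydown.lean` ED. 1 (`stub_ShRao_of_conv` :209–233, `stub_ShSpan_of_spanE` :288–322, `n6nsShalikaOdd_of_organs` :324–398; LH4-plan (g2),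
LH3-p02 (g0), LH10-p01 (g2)) transcribed with the single token swap `IsUnit (2 : 𝒪[L_w]) ↦ Algebra.IsUnramifiedIn (𝓞 L) v.asIdeal` (and the `𝒪`-bridge of :311 dropped — it only
transported the parity hypothesis).

* `UnitaryGroup.exists_orbitalMeasureFamily_rao_unipotent_antidiagOne_three_nonsplit` — ‹RAO› at EVERY non-split place (no ramification ∕ parity hypothesis): an
  orbital-measure family admissible at the unipotent classes WITH Ranga-Rao's clause (★ p849258 + ★ p850112).
* `UnitaryGroup.howeSpan_unipotent_antidiagOne_three_unramified` — ‹SPAN› at an unramified non-split place: Howe's span property for the set of unipotent classes (★ p849233 +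
  ★ p850186 + ★ `npow_conj_sub_one_eq_zero_iff` + ★ `totallyDisconnectedSpace_cmDatum_local`).
* **`UnitaryGroup.shalikaGermExpansionNonsplit_antidiagOne_three_unramified`** — THE HEAD: `ShalikaGermExpansionNonsplit L Φ₃ v` at every unramified non-split `v`.

## References
* [Rogawski1990] J. D. Rogawski, *Automorphic Representations of Unitary Groups in Three Variables*, Ann. of Math. Stud. 123 (1990): §8.1 Props. 8.1.1–8.1.2 pp. 112–114; §3.9
  Prop. 3.9.1 p. 32; §4.9 p. 54.
* [Rao1972] R. Ranga Rao, *Orbital integrals in reductive groups*, Ann. of Math. (2) 96 (1972) 505–510.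
* [Howe1974] R. Howe, *The Fourier transform and germs of characters (case of GL_n over a p-adic field)*, Math. Ann. 208 (1974) 305–322, Prop. 2.
* [HarishChandra1999AdmissibleDistributions] Harish-Chandra (notes by S. DeBacker, P. J. Sally, Jr.), *Admissible Invariant Distributions on Reductive p-adic Groups*, AMS ULS 16
  (1999): Thm. 8.1 p. 48; §3.1 p. 17.
-/

set_option autoImplicit false

noncomputable section

namespace Literature.NumberTheory.Rogawski1990

open _root_.MeasureTheory _root_.MeasureTheory.Measure _root_.NumberField IsDedekindDomain _root_.Topology Filter
open Literature.MeasureTheory.Group Literature.NumberTheory.Automorphic Literature.NumberTheory.Automorphic.UnitaryGroup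
open Literature.NumberTheory.GaloisRepresentations
open scoped Matrix MatrixGroups Classical ValuativeRel

/-! ## §1 ‹RAO› at every non-split place: admissible orbital measures at the unipotent classes WITH Ranga-Rao's clause -/

set_option maxHeartbeats 400000 in
-- statement-heavy: four instance binders
/-- **‹RAO› AT EVERY NON-SPLIT PLACE (any residue characteristic, any ramification)**: on `G = U(Φ₃)(L⁺_v)` there is an orbital-measure family `mU` ADMISSIBLE at every
unipotent class (non-zero, `G`-invariant, finite on compacta on `G ⧸ G_u` — ★ p849258 `…_antidiagOne_three_nonsplit`, Rao existence with the compact-centraliser input ★ CENT-BDD)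
satisfying RANGA-RAO'S CLAUSE: `y ↦ f(y u y⁻¹)` is `mU u`-integrable for every `f ∈ C_c^∞(G)` and every unipotent class `u` (★ p850112
`UnitaryGroup.integrable_descConj_of_isLocSmooth_of_unipotent'`, the three-way split `u = 1` ∕ transvection ∕ regular, hypothesis-free).  = leaf `F0_P3c_ShalikaPaydown` organ
`stub_ShRao_of_conv` :209–233 with the token `IsUnit (2 : 𝒪[w.1.adicCompletion L]) →` deleted.
[cite: Rao1972, Theorem] [cite: Rogawski1990, §8.1 p. 112; §4.9 p. 54] [cite: HarishChandra1999AdmissibleDistributions, §3.1 p. 17] -/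
theorem UnitaryGroup.exists_orbitalMeasureFamily_rao_unipotent_antidiagOne_three_nonsplit :
    ∀ (L : Type) [Field L] [NumberField L] [IsCMField L] (v : HeightOneSpectrum (𝓞 ↥(maximalRealSubfield L))) (w : UnitaryGroup.PlacesOver L v),
      Subsingleton (UnitaryGroup.PlacesOver L v) →
      ∀ [MeasurableSpace ((cmDatum L 3 (Matrix.of fun i j : Fin 3 => if i.val + j.val + 1 = 3 then (1 : L) else 0)).Local v)] [BorelSpace ((cmDatum L 3 (Matrix.of fun i j : Fin 3 => if i.val + j.val + 1 = 3 then (1 : L) else 0)).Local v)]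
        [∀ γ : ((cmDatum L 3 (Matrix.of fun i j : Fin 3 => if i.val + j.val + 1 = 3 then (1 : L) else 0)).Local v), MeasurableSpace (((cmDatum L 3 (Matrix.of fun i j : Fin 3 => if i.val + j.val + 1 = 3 then (1 : L) else 0)).Local v) ⧸ Subgroup.centralizer ({γ} : Set ((cmDatum L 3 (Matrix.of fun i j : Fin 3 => if i.val + j.val + 1 = 3 then (1 : L) else 0)).Local v)))]
        [∀ γ : ((cmDatum L 3 (Matrix.of fun i j : Fin 3 => if i.val + j.val + 1 = 3 then (1 : L) else 0)).Local v), BorelSpace (((cmDatum L 3 (Matrix.of fun i j : Fin 3 => if i.val + j.val + 1 = 3 then (1 : L) else 0)).Local v) ⧸ Subgroup.centralizer ({γ} : Set ((cmDatum L 3 (Matrix.of fun i j : Fin 3 => if i.val + j.val + 1 = 3 then (1 : L) else 0)).Local v)))],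
      ∃ mU : OrbitalMeasureFamily ((cmDatum L 3 (Matrix.of fun i j : Fin 3 => if i.val + j.val + 1 = 3 then (1 : L) else 0)).Local v),
        mU.IsAdmissibleOn (fun γ : ((cmDatum L 3 (Matrix.of fun i j : Fin 3 => if i.val + j.val + 1 = 3 then (1 : L) else 0)).Local v) => (((γ).val : GL (Fin 3) (UnitaryGroup.LocalRing L v)).val - 1) ^ 3 = 0) ∧
        ∀ u : ConjClasses ((cmDatum L 3 (Matrix.of fun i j : Fin 3 => if i.val + j.val + 1 = 3 then (1 : L) else 0)).Local v), (((Quotient.out u : ((cmDatum L 3 (Matrix.of fun i j : Fin 3 => if i.val + j.val + 1 = 3 then (1 : L) else 0)).Local v)).val : GL (Fin 3) (UnitaryGroup.LocalRing L v)).val - 1) ^ 3 = 0 →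
          ∀ f : ((cmDatum L 3 (Matrix.of fun i j : Fin 3 => if i.val + j.val + 1 = 3 then (1 : L) else 0)).Local v) → ℂ, IsLocSmooth f →
            Integrable (descConj (Quotient.out u : ((cmDatum L 3 (Matrix.of fun i j : Fin 3 => if i.val + j.val + 1 = 3 then (1 : L) else 0)).Local v)) (Subgroup.centralizer ({(Quotient.out u : ((cmDatum L 3 (Matrix.of fun i j : Fin 3 => if i.val + j.val + 1 = 3 then (1 : L) else 0)).Local v))} : Set ((cmDatum L 3 (Matrix.of fun i j : Fin 3 => if i.val + j.val + 1 = 3 then (1 : L) else 0)).Local v)))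
              (fun _ hg => Subgroup.mem_centralizer_singleton_iff.1 hg) f) (mU u) := by
  intro L _ _ _ v w hsub _ _ _ _
  obtain ⟨mU, hmU, -⟩ := UnitaryGroup.exists_orbitalMeasureFamily_isAdmissibleOn_unipotent_antidiagOne_three_nonsplit L v w hsub
  refine ⟨mU, hmU, fun u hu f hf => ?_⟩
  obtain ⟨-, hinv, hfin⟩ := hmU u hu
  haveI := hinv
  haveI := hfin
  exact UnitaryGroup.integrable_descConj_of_isLocSmooth_of_unipotent' L v w hsub (Quotient.out u) hu (mU u) f hf

/-! ## §2 ‹SPAN› at an unramified non-split place: Howe's span property for the unipotent classes -/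

set_option maxHeartbeats 400000 in
-- statement-heavy: four instance binders
/-- **‹SPAN› AT AN UNRAMIFIED NON-SPLIT PLACE (any residue characteristic) — HOWE'S SPAN PROPERTY for `G = U(Φ₃)(L⁺_v)`**, `S` = THE set of unipotent classes, `mU` admissible
on `S` with Ranga-Rao's clause: every `F ∈ C_c^∞(G)` whose unipotent orbital integrals all vanish is `F₀ + F₁` with `F₀ ∈ span_ℂ {φ^x − φ}` (`φ ∈ C_c^∞`) and `tsupport F₁` off the
unipotent variety.  Proof: ★ p849233 `exists_add_mem_span_conj_sub_of_classOrbitalIntegral_eq_zero` (generic, for a finite closed-filtered orbit stratification) at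
`P γ := (γ − 1)³ = 0` (conjugation-invariant by ★ `npow_conj_sub_one_eq_zero_iff`), the closed filtration being ★ p850186 `exists_enum_unipotent_isClosed_iUnion_lt_antidiagOne_unramified`;
`G` is totally disconnected by ★ `totallyDisconnectedSpace_cmDatum_local`.  = leaf organ `stub_ShSpan_of_spanE` :288–322 with `IsUnit (2 : 𝒪[L_w]) ↦ Algebra.IsUnramifiedIn (𝓞 L) v.asIdeal`.
[cite: Howe1974, Prop. 2] [cite: HarishChandra1999AdmissibleDistributions, Thm. 8.1 p. 48] [cite: Rogawski1990, §8.1 pp. 112–113] -/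
theorem UnitaryGroup.howeSpan_unipotent_antidiagOne_three_unramified :
    ∀ (L : Type) [Field L] [NumberField L] [IsCMField L] (v : HeightOneSpectrum (𝓞 ↥(maximalRealSubfield L))) (w : UnitaryGroup.PlacesOver L v),
      Subsingleton (UnitaryGroup.PlacesOver L v) → Algebra.IsUnramifiedIn (𝓞 L) v.asIdeal →
      ∀ [MeasurableSpace ((cmDatum L 3 (Matrix.of fun i j : Fin 3 => if i.val + j.val + 1 = 3 then (1 : L) else 0)).Local v)] [BorelSpace ((cmDatum L 3 (Matrix.of fun i j : Fin 3 => if i.val + j.val + 1 = 3 then (1 : L) else 0)).Local v)]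
        [∀ γ : ((cmDatum L 3 (Matrix.of fun i j : Fin 3 => if i.val + j.val + 1 = 3 then (1 : L) else 0)).Local v), MeasurableSpace (((cmDatum L 3 (Matrix.of fun i j : Fin 3 => if i.val + j.val + 1 = 3 then (1 : L) else 0)).Local v) ⧸ Subgroup.centralizer ({γ} : Set ((cmDatum L 3 (Matrix.of fun i j : Fin 3 => if i.val + j.val + 1 = 3 then (1 : L) else 0)).Local v)))]
        [∀ γ : ((cmDatum L 3 (Matrix.of fun i j : Fin 3 => if i.val + j.val + 1 = 3 then (1 : L) else 0)).Local v), BorelSpace (((cmDatum L 3 (Matrix.of fun i j : Fin 3 => if i.val + j.val + 1 = 3 then (1 : L) else 0)).Local v) ⧸ Subgroup.centralizer ({γ} : Set ((cmDatum L 3 (Matrix.of fun i j : Fin 3 => if i.val + j.val + 1 = 3 then (1 : L) else 0)).Local v)))],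
      ∀ (S : Finset (ConjClasses ((cmDatum L 3 (Matrix.of fun i j : Fin 3 => if i.val + j.val + 1 = 3 then (1 : L) else 0)).Local v))) (mU : OrbitalMeasureFamily ((cmDatum L 3 (Matrix.of fun i j : Fin 3 => if i.val + j.val + 1 = 3 then (1 : L) else 0)).Local v)),
        (∀ c : ConjClasses ((cmDatum L 3 (Matrix.of fun i j : Fin 3 => if i.val + j.val + 1 = 3 then (1 : L) else 0)).Local v), c ∈ S ↔ (((Quotient.out c : ((cmDatum L 3 (Matrix.of fun i j : Fin 3 => if i.val + j.val + 1 = 3 then (1 : L) else 0)).Local v)).val : GL (Fin 3) (UnitaryGroup.LocalRing L v)).val - 1) ^ 3 = 0) →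
        mU.IsAdmissibleOn (fun γ : ((cmDatum L 3 (Matrix.of fun i j : Fin 3 => if i.val + j.val + 1 = 3 then (1 : L) else 0)).Local v) => (ConjClasses.mk γ) ∈ S) →
        (∀ u ∈ S, ∀ f : ((cmDatum L 3 (Matrix.of fun i j : Fin 3 => if i.val + j.val + 1 = 3 then (1 : L) else 0)).Local v) → ℂ, IsLocSmooth f →
            Integrable (descConj (Quotient.out u : ((cmDatum L 3 (Matrix.of fun i j : Fin 3 => if i.val + j.val + 1 = 3 then (1 : L) else 0)).Local v)) (Subgroup.centralizer ({(Quotient.out u : ((cmDatum L 3 (Matrix.of fun i j : Fin 3 => if i.val + j.val + 1 = 3 then (1 : L) else 0)).Local v))} : Set ((cmDatum L 3 (Matrix.of fun i j : Fin 3 => if i.val + j.val + 1 = 3 then (1 : L) else 0)).Local v)))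
              (fun _ hg => Subgroup.mem_centralizer_singleton_iff.1 hg) f) (mU u)) →
        ∀ F : ((cmDatum L 3 (Matrix.of fun i j : Fin 3 => if i.val + j.val + 1 = 3 then (1 : L) else 0)).Local v) → ℂ, IsLocSmooth F → (∀ u ∈ S, classOrbitalIntegral mU F u = 0) →
          ∃ F₀ F₁ : ((cmDatum L 3 (Matrix.of fun i j : Fin 3 => if i.val + j.val + 1 = 3 then (1 : L) else 0)).Local v) → ℂ, F = F₀ + F₁ ∧
            F₀ ∈ Submodule.span ℂ {ψ : ((cmDatum L 3 (Matrix.of fun i j : Fin 3 => if i.val + j.val + 1 = 3 then (1 : L) else 0)).Local v) → ℂ |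
              ∃ (x : ((cmDatum L 3 (Matrix.of fun i j : Fin 3 => if i.val + j.val + 1 = 3 then (1 : L) else 0)).Local v)) (φ : ((cmDatum L 3 (Matrix.of fun i j : Fin 3 => if i.val + j.val + 1 = 3 then (1 : L) else 0)).Local v) → ℂ), IsLocSmooth φ ∧ ψ = (fun g => φ (x * g * x⁻¹)) - φ} ∧
            ∀ g ∈ tsupport F₁, (((g).val : GL (Fin 3) (UnitaryGroup.LocalRing L v)).val - 1) ^ 3 ≠ 0 := by
  intro L _ _ _ v w hsub hv _ _ _ _ S mU hS hmU hRao F hF h0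
  haveI : TotallyDisconnectedSpace ((cmDatum L 3 (Matrix.of fun i j : Fin 3 => if i.val + j.val + 1 = 3 then (1 : L) else 0)).Local v) :=
    totallyDisconnectedSpace_cmDatum_local L 3 _ v
  obtain ⟨n, e, he, hcl⟩ := exists_enum_unipotent_isClosed_iUnion_lt_antidiagOne_unramified L v w hsub hv S hS
  exact exists_add_mem_span_conj_sub_of_classOrbitalIntegral_eq_zero
    (fun γ : ((cmDatum L 3 (Matrix.of fun i j : Fin 3 => if i.val + j.val + 1 = 3 then (1 : L) else 0)).Local v) => ((γ.val : GL (Fin 3) (UnitaryGroup.LocalRing L v)).val - 1) ^ 3 = 0) S hS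
    (fun g x => npow_conj_sub_one_eq_zero_iff L _ v g x 3) ⟨n, e, he, hcl⟩ mU hmU hRao F hF h0

/-! ## §3 THE HEAD — Shalika at `Φ₃` at every unramified non-split place -/

set_option maxHeartbeats 800000 in
-- statement-light, proof-heavy: the Howe package is assembled under the plug's four instance binders
/-- **THE SHALIKA GERM EXPANSION FOR `U(Φ₃)(L⁺_v)` AT EVERY UNRAMIFIED NON-SPLIT PLACE — ODD OR DYADIC — IN-HOUSE.**  For a CM field `L`, a finite place `v` of `L⁺` unramified in
`L` with one place `w` of `L` above it: ★ `ShalikaGermExpansionNonsplit L Φ₃ v` (the germ expansion of the regular-semisimple orbital integrals near `1` along the unipotent orbital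
integrals, [Rogawski1990] Prop. 8.1.1).  Proof: the ★ SH-3 plug `UnitaryGroup.shalikaGermExpansionNonsplit_of_howePackage` («Prop. 8.1.1 ⟸ HOWE PACKAGE», with ★ `antidiagOne_isHermitian L 3`,
★ `(isUnit_antidiagOne_det L 3).ne_zero`) fed with: `S` from ★ ‹U-FIN-unr› `unitaryThree_unipotent_conjClasses_finite_unramified`; `mU` + Rao clause from §1; the dual pieces from
★ ‹DUAL-unr› `UnitaryGroup.exists_unipotentDualPieces_antidiagOne_unramified`; the span property from §2 — the glue `n6nsShalikaOdd_of_organs` :324–398 of the ODD leaf with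
`IsUnit (2 : 𝒪[L_w]) ↦ Algebra.IsUnramifiedIn (𝓞 L) v.asIdeal`.
[cite: Rogawski1990, §8.1 Prop. 8.1.1 pp. 112–113] [cite: Howe1974, Prop. 2] [cite: Rao1972, Theorem] [cite: HarishChandra1999AdmissibleDistributions, Thm. 8.1 p. 48] -/
theorem UnitaryGroup.shalikaGermExpansionNonsplit_antidiagOne_three_unramified (L : Type) [Field L] [NumberField L] [IsCMField L]
    (v : HeightOneSpectrum (𝓞 ↥(maximalRealSubfield L))) (w : UnitaryGroup.PlacesOver L v) (hsub : Subsingleton (UnitaryGroup.PlacesOver L v))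
    (hv : Algebra.IsUnramifiedIn (𝓞 L) v.asIdeal) :
    ShalikaGermExpansionNonsplit L (Matrix.of fun i j : Fin 3 => if i.val + j.val + 1 = 3 then (1 : L) else 0) v := by
  refine UnitaryGroup.shalikaGermExpansionNonsplit_of_howePackage L (Matrix.of fun i j : Fin 3 => if i.val + j.val + 1 = 3 then (1 : L) else 0) v
    (antidiagOne_isHermitian L 3) (isUnit_antidiagOne_det L 3).ne_zero ?_
  intro _ _ _ _
  obtain ⟨S, hS⟩ := unitaryThree_unipotent_conjClasses_finite_unramified L v w hsub hv
  obtain ⟨mU, hadm, hraoU⟩ := UnitaryGroup.exists_orbitalMeasureFamily_rao_unipotent_antidiagOne_three_nonsplit L v w hsub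
  have hmk : ∀ c : ConjClasses ((cmDatum L 3 (Matrix.of fun i j : Fin 3 => if i.val + j.val + 1 = 3 then (1 : L) else 0)).Local v), ConjClasses.mk (Quotient.out c) = c :=
    fun c => Quotient.out_eq c
  have hunip : ∀ u ∈ S, (((Quotient.out u : ((cmDatum L 3 (Matrix.of fun i j : Fin 3 => if i.val + j.val + 1 = 3 then (1 : L) else 0)).Local v)).val : GL (Fin 3) (UnitaryGroup.LocalRing L v)).val - 1) ^ 3 = 0 :=
    fun u hu => (hS u).1 hu
  have hadmS : mU.IsAdmissibleOn (fun γ : ((cmDatum L 3 (Matrix.of fun i j : Fin 3 => if i.val + j.val + 1 = 3 then (1 : L) else 0)).Local v) => (ConjClasses.mk γ) ∈ S) := by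
    intro c hc
    have hc' : c ∈ S := by simpa only [hmk] using hc
    exact hadm c ((hS c).1 hc')
  have hraoS : ∀ u ∈ S, ∀ f : ((cmDatum L 3 (Matrix.of fun i j : Fin 3 => if i.val + j.val + 1 = 3 then (1 : L) else 0)).Local v) → ℂ, IsLocSmooth f →
      Integrable (descConj (Quotient.out u : ((cmDatum L 3 (Matrix.of fun i j : Fin 3 => if i.val + j.val + 1 = 3 then (1 : L) else 0)).Local v)) (Subgroup.centralizer ({(Quotient.out u : ((cmDatum L 3 (Matrix.of fun i j : Fin 3 => if i.val + j.val + 1 = 3 then (1 : L) else 0)).Local v))} : Set ((cmDatum L 3 (Matrix.of fun i j : Fin 3 => if i.val + j.val + 1 = 3 then (1 : L) else 0)).Local v)))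
        (fun _ hg => Subgroup.mem_centralizer_singleton_iff.1 hg) f) (mU u) :=
    fun u hu => hraoU u (hunip u hu)
  obtain ⟨fd, hfd, h1, h0⟩ := UnitaryGroup.exists_unipotentDualPieces_antidiagOne_unramified L v w hsub hv S mU hunip hadmS hraoS
  exact ⟨S, mU, fd, hunip, hadmS, hraoS, hfd, h1, h0,
    UnitaryGroup.howeSpan_unipotent_antidiagOne_three_unramified L v w hsub hv S mU hS hadmS hraoS⟩

end Literature.NumberTheory.Rogawski1990

end
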